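import Literature.Analysis.FluidPDE.NSCriticalClosure
import Literature.Analysis.FluidPDE.NSLerayHopf
import Literature.Analysis.FluidPDE.NSLerayHopfProofs
import Literature.Analysis.FluidPDE.TaoLocalisation
import Literature.Analysis.FluidPDE.TaoLocalisationProofs
import Literature.Analysis.FluidPDE.ClassicalSolutionGlue
import Literature.Analysis.FluidPDE.LerayHopfTranslate
import HarnessLib

/-!
# The `L³` continuation criterion — assemblies of `NS.hasSmoothExtensionPast_of_eLpNorm_three_bounded`

`Literature.Analysis.FluidPDE.NSCriticalClosure` records the named fact
`Literature.Analysis.FluidPDE.hasSmoothExtensionPast_of_eLpNorm_three_bounded` (route `MonotoneCritical`, crux #3, "ESS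
shape"): a classical solution of the unforced Navier–Stokes system on `ℝ³ × [0, T)` which is a
Leray–Hopf solution from its rapidly decaying datum and satisfies `sup_{0 ≤ t < T} ‖u(t)‖_{L³} < ∞`
extends as a classical solution past `T`.

In print this is the contrapositive of the `L³` blow-up criterion:

* **Seregin 2012, Thm. 1.1** (Comm. Math. Phys. 312, 833–845 = arXiv:1104.3615, p. 2): "Let `v`
  be an energy solution to the Cauchy problem (1.1), (1.2) with the initial data satisfying (1.3).
  Let `T > 0` be a finite blow up time. Then `lim_{t → T-0} ‖v(·, t)‖₃ = ∞` holds true." (sharpening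
  the `limsup` statement (1.6) of Escauriaza–Seregin–Šverák 2003, Thm. 1.3); the proof (pp. 3–6)
  assumes `sup_k ‖v(·, t_k)‖₃ = M < ∞` along `t_k ↑ T` ((2.1)), rescales around a singular point,
  extracts a non-trivial local energy solution vanishing at the final time, and contradicts the
  backward uniqueness theorem of ESS 2003. In the tree: the named fact `Literature.Analysis.FluidPDE.seregin_L3_blowup`
  (`NSLerayHopf.lean`), stated for maximal smooth solutions (`Fluid.IsMaximalSmoothSolution`:
  classical on `[0, T)`, no classical continuation past `T`) which are Leray–Hopf from a datum in
  `L² ∩ L³` and essentially bounded on every closed sub-strip `[0, T'] × ℝ³`, `T' < T` (Seregin's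
  "smooth for `t < T`", p. 2: regular point = essentially bounded in a parabolic ball).
* Since the hypothesis of the vendored fact is the uniform bound `sup_{[0,T)} ‖u(t)‖₃ < ∞` (not
  merely `liminf < ∞`), the `limsup` form — Escauriaza–Seregin–Šverák 2003, Thm. 1.3 with §3 —
  already suffices, and of it only the intermediate statement **(3.5)–(3.6)** is needed: a
  Leray–Hopf solution of the Cauchy problem in `L^∞(0, T; L³)` is essentially bounded on
  `ℝ³ × (δ, T)` for every `δ > 0` (named fact `Literature.Analysis.FluidPDE.ess_sup_bound`, `NSLerayHopfProofs.lean`).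
  Boundedness up to the putative blow-up time is then excluded by **Leray 1934, §20 (3.9)**
  ("premier caractère des irrégularités": `V(t) √(T - t) ≥ A √ν` for a regular solution becoming
  irregular at `T`; named fact `Literature.Analysis.FluidPDE.leray_blowup_rate_top`, `NSLerayHopf.lean`).

This file **proves two assemblies**:

1. `NS.hasSmoothExtensionPast_of_eLpNorm_three_bounded_of_seregin`:
   `seregin_L3_blowup ∧ tao2011_hasBoundedSobolevNormsOn → hasSmoothExtensionPast_of_eLpNorm_three_bounded`
   (the side condition "bounded on closed sub-strips" of Seregin's fact being, for a classical
   Leray–Hopf solution from a Schwartz datum, Tao 2013, Cor. 11.1 + Cor. 4.3 + Thm. 5.4 (iv) —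
   regularity persistence on closed slabs, named fact `Literature.Analysis.FluidPDE.tao2011_hasBoundedSobolevNormsOn` —
   followed by the Sobolev imbedding `H² ⊂ C_B`, `Literature.Analysis.FluidPDE.linfty_bound_of_hasBoundedSobolevNormsOn`,
   discharged in `TaoLocalisationProofs.lean`), with the finer form `…_of_parts`;
2. `NS.hasSmoothExtensionPast_of_eLpNorm_three_bounded_of_ess_sup_bound`:
   `ess_sup_bound ∧ leray_blowup_rate_top → hasSmoothExtensionPast_of_eLpNorm_three_bounded`,
   whose two inputs are more elementary published statements (ESS (3.6) is one step of the proof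
   of ESS Thm. 1.3, of which Seregin's theorem is a sharpening; Leray's 1934 rate is classical
   local theory and replaces Tao's 2013 localisation theory). This is the preferred decomposition
   of the fact.

## The proof of assembly 2 (ESS 2003, §3; Leray 1934, §20)

Suppose `u` does not extend past `T`, so that `(u, p)` is a maximal smooth solution with
lifespan `T`. The slices `u(t)`, `t ∈ [0, T)`, are continuous with `‖u(t)‖₃ ≤ sup < ∞`, so
`u ∈ L^∞(0, T; L³)`; the datum `u(0)` lies in `J̊` (Leray–Hopf). By ESS (3.6), `u` is essentially
bounded on `ℝ³ × (δ, T)` for every `δ > 0`, hence — `u` being continuous there — bounded by some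
`M` (an open null set is empty). Fix a time `s ∈ (0, T)` from which the energy inequality holds;
the translate `u(· + s)` is then a Leray–Hopf solution on `[0, T - s)` from `u(s)`
(`Fluid.IsLerayHopfOn.exists_isLerayHopfOn_translate`, `LerayHopfTranslate.lean`), a maximal
smooth solution with lifespan `T - s` (`Fluid.IsMaximalSmoothSolution.translate_zero`,
`ClassicalSolutionGlue.lean`: an extension of the translate would glue to an extension of `u`),
and bounded by `M` on every closed sub-strip `[0, T'] × ℝ³`, `T' < T - s`. Leray's theorem gives
`‖u(t + s)‖_∞ ≥ c √ν / √(T - s - t)` for all `t < T - s`, i.e. `c √ν / √ε ≤ M` for all small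
`ε > 0` — absurd.

## The proof of assembly 1 (contrapositive, as in Seregin 2012, §2, (2.1))

Suppose `u` does not extend past `T`. Then `(u, p)` is a maximal smooth solution with lifespan `T`
(`Fluid.IsMaximalSmoothSolution ν 0 u p T`, by definition). Its datum `u 0` is continuous and
`‖u 0‖₃ ≤ sup_{[0,T)} ‖u(t)‖₃ < ∞`, so `u 0 ∈ L³`. On every closed sub-strip `[0, T']`, `T' < T`,
`(u, p)` is a classical solution (`IsClassicalNSSolutionOn.mono`) of finite energy (Leray–Hopf energy
inequality, `IsLerayHopfOn.lintegral_enorm_sq_le`), hence has all Sobolev norms bounded (Tao) and is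
bounded (Sobolev imbedding), in particular essentially bounded on `[0, T'] × ℝ³`. Seregin's theorem
now gives `‖u(t)‖₃ → ∞` as `t ↑ T`, which is absurd since `‖u(t)‖₃ ≤ sup_{[0,T)} ‖u‖₃ < ∞` for all
`t ∈ [0, T)`, a left neighbourhood of `T`.

## What remains for an unconditional `hasSmoothExtensionPast_of_eLpNorm_three_bounded_holds`

Via assembly 2: the discharge of `NS.ess_sup_bound` (ESS 2003, Thm. 1.4 — local Hölder
regularity of `L_{3,∞}` suitable weak solutions by blow-up, backward uniqueness Thm. 5.1 and
unique continuation Thm. 4.1 (vendored as `NS.ess_backward_uniqueness`, `NS.ess_unique_continuation`)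
— together with scaling, the associated pressure (3.2)–(3.4) and ε-regularity Lemma 2.2) and of
`NS.leray_blowup_rate_top` (Leray 1934, §§19–22: local existence of regular solutions from bounded
finite-energy data with existence time `≥ A ν³ V⁻⁴`, and uniqueness).

## References

* G. Seregin, *A certain necessary condition of potential blow up for Navier–Stokes equations*,
  Comm. Math. Phys. 312 (2012), 833–845; arXiv:1104.3615, Thm. 1.1 (p. 2), §2 (2.1) (p. 3).
* L. Escauriaza, G. Seregin, V. Šverák, *`L_{3,∞}`-solutions of Navier–Stokes equations and
  backward uniqueness*, Russ. Math. Surveys 58:2 (2003), 211–250, Thm. 1.3, §3 (3.5)–(3.6).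
* J. Leray, *Sur le mouvement d'un liquide visqueux emplissant l'espace*, Acta Math. 63 (1934),
  §20 (3.9), §34.
* T. Tao, *Localisation and compactness properties of the Navier–Stokes global regularity
  problem*, Anal. PDE 6 (2013), 25–107 = arXiv:1108.1165, Cor. 11.1, Cor. 4.3, Thm. 5.4 (iv).
* R. A. Adams, J. J. F. Fournier, *Sobolev Spaces*, 2nd ed. (2003), Thm. 4.12 Part I Case A.
-/

noncomputable section

open MeasureTheory Set Function Filter Topology
open scoped ENNReal NNReal

namespace Literature.Analysis.FluidPDE

/-! ### Glue -/

/-- A field bounded pointwise on `S × ℝ³` is essentially bounded there: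
`‖uncurry u‖_{L^∞(S × ℝ³)} < ∞` (the form of the boundedness hypothesis of
`NS.seregin_L3_blowup` and `NS.leray_blowup_rate_top`). [folklore] -/
theorem eLpNorm_uncurry_top_lt_top_of_bound {S : Set ℝ} (hS : MeasurableSet S)
    {u : ℝ → EuclideanSpace ℝ (Fin 3) → EuclideanSpace ℝ (Fin 3)} {C : ℝ}
    (hC : ∀ t ∈ S, ∀ x, ‖u t x‖ ≤ C) :
    eLpNorm (uncurry u) ∞
      ((volume : Measure (ℝ × EuclideanSpace ℝ (Fin 3))).restrict (S ×ˢ univ)) < ∞ := by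
  rw [eLpNorm_exponent_top]
  refine eLpNormEssSup_lt_top_of_ae_bound (C := C) ?_
  refine (ae_restrict_iff' (hS.prod MeasurableSet.univ)).2 (Eventually.of_forall ?_)
  rintro ⟨t, x⟩ ⟨ht, -⟩
  exact hC t ht x

/-- **Boundedness on closed sub-strips** (Tao 2013, Cor. 11.1 + Cor. 4.3 + Thm. 5.4 (iv), with the
Sobolev imbedding `H² ⊂ L^∞`, Adams–Fournier Thm. 4.12): given the named fact
`tao2011_hasBoundedSobolevNormsOn`, a classical unforced solution on `[0, T) × ℝ³` which is
Leray–Hopf from its rapidly decaying datum is essentially bounded on `[0, T'] × ℝ³` for every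
`0 < T' < T` — the regularity hypothesis of `NS.seregin_L3_blowup`. Proof: restrict to the closed
slab `[0, T']`, where the energy is bounded by the initial energy, apply
`tao2011_hasBoundedSobolevNormsOn.closedSlab` and the discharged imbedding
`linfty_bound_of_hasBoundedSobolevNormsOn_holds`. [cite: Tao2011, Cor. 11.1 + Cor. 4.3 + Thm. 5.4 (iv)] -/
theorem eLpNorm_uncurry_top_lt_top_of_tao2011 (hB : tao2011_hasBoundedSobolevNormsOn) {ν T : ℝ}
    (hν : 0 < ν) {u : ℝ → EuclideanSpace ℝ (Fin 3) → EuclideanSpace ℝ (Fin 3)}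
    {p : ℝ → EuclideanSpace ℝ (Fin 3) → ℝ}
    (hsol : FluidPDE.IsClassicalNSSolutionOn (Ico 0 T) ν 0 u p)
    (hLH : FluidPDE.IsLerayHopfOn T ν 0 (u 0) u) (h₀ : HasRapidSpatialDecay (u 0)) :
    ∀ T' ∈ Ioo 0 T, eLpNorm (uncurry u) ∞
      ((volume : Measure (ℝ × EuclideanSpace ℝ (Fin 3))).restrict (Icc 0 T' ×ˢ univ)) < ∞ := by
  intro T' hT'
  -- restrict to the closed slab `[0, T']`
  have hsol' : FluidPDE.IsClassicalNSSolutionOn (Icc 0 T') ν 0 u p :=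
    hsol.mono (Icc_subset_Ico_right hT'.2) (uniqueDiffOn_Icc hT'.1)
  -- finite energy on `[0, T']` from the Leray–Hopf energy inequality
  have hE : ∃ C : ℝ≥0∞, C < ⊤ ∧ ∀ t ∈ Icc 0 T', ∫⁻ x, ‖u t x‖ₑ ^ 2 ≤ C :=
    ⟨ENNReal.ofReal (2 * VectorCalculus.kineticEnergy (u 0)), ENNReal.ofReal_lt_top, fun t ht =>
      hLH.lintegral_enorm_sq_le hν.le ⟨ht.1, ht.2.trans hT'.2.le⟩⟩
  -- all Sobolev norms bounded on the closed slab (Tao), hence a uniform bound (Sobolev imbedding)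
  have hH : HasBoundedSobolevNormsOn (Icc 0 T') u :=
    (tao2011_hasBoundedSobolevNormsOn.closedSlab hB linfty_bound_of_hasBoundedSobolevNormsOn_holds
      ν T' hν hT'.1 u p hsol' hE h₀).1
  have hC2 : ∀ t ∈ Icc 0 T', ContDiff ℝ 2 (u t) := fun t ht =>
    (hsol'.contDiff_velocity ht).of_le (by norm_cast)
  obtain ⟨C, hC⟩ := linfty_bound_of_hasBoundedSobolevNormsOn_holds hC2 hH
  exact eLpNorm_uncurry_top_lt_top_of_bound measurableSet_Icc hC

/-- A uniform `L³` bound on `[0, T)` is incompatible with `‖u(t)‖₃ → ∞` as `t ↑ T` (`T > 0`):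
`[0, T)` is a left neighbourhood of `T` on which the norms stay below the (finite) supremum.
[folklore] -/
theorem not_tendsto_eLpNorm_three_top_of_iSup_lt_top {T : ℝ} (hT : 0 < T)
    {u : ℝ → EuclideanSpace ℝ (Fin 3) → EuclideanSpace ℝ (Fin 3)}
    (h : (⨆ t ∈ Ico 0 T, eLpNorm (u t) 3 volume) < ⊤) :
    ¬ Tendsto (fun t => eLpNorm (u t) 3 volume) (𝓝[<] T) (𝓝 ∞) := by
  intro hlim
  have hle : ∀ t ∈ Ico (0 : ℝ) T, eLpNorm (u t) 3 volume ≤ ⨆ t ∈ Ico 0 T, eLpNorm (u t) 3 volume :=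
    fun t ht => le_iSup₂ (f := fun t (_ : t ∈ Ico (0 : ℝ) T) => eLpNorm (u t) 3 volume) t ht
  have hev : ∀ᶠ t in 𝓝[<] T, eLpNorm (u t) 3 volume ≤ ⨆ t ∈ Ico 0 T, eLpNorm (u t) 3 volume := by
    filter_upwards [Ico_mem_nhdsLT hT] with t ht using hle t ht
  have hgt : ∀ᶠ t in 𝓝[<] T, (⨆ t ∈ Ico 0 T, eLpNorm (u t) 3 volume) < eLpNorm (u t) 3 volume :=
    hlim.eventually (lt_mem_nhds h)
  obtain ⟨t, h₁, h₂⟩ := (hev.and hgt).exists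
  exact absurd h₂ (not_lt.2 h₁)

/-- **`L^∞(0, T; L³)` from the uniform bound.** If the slices `u(t)`, `t ∈ [0, T)`, are a.e.
strongly measurable and `sup_{t ∈ [0,T)} ‖u(t)‖₃ < ∞`, then `u ∈ L^∞(0, T; L³(ℝ³))` in the guarded
sense `Fluid.MemLqLp ∞ 3 u (Ioo 0 T)` (hypothesis (1.13) of Escauriaza–Seregin–Šverák 2003).
[folklore] -/
theorem memLqLp_top_three_of_iSup_lt_top {T : ℝ}
    {u : ℝ → EuclideanSpace ℝ (Fin 3) → EuclideanSpace ℝ (Fin 3)}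
    (hmeas : ∀ t ∈ Ico 0 T, AEStronglyMeasurable (u t) volume)
    (h : (⨆ t ∈ Ico 0 T, eLpNorm (u t) 3 volume) < ⊤) : FluidPDE.MemLqLp ∞ 3 u (Ioo 0 T) := by
  have hle : ∀ t ∈ Ico (0 : ℝ) T, eLpNorm (u t) 3 volume ≤ ⨆ t ∈ Ico 0 T, eLpNorm (u t) 3 volume :=
    fun t ht => le_iSup₂ (f := fun t (_ : t ∈ Ico (0 : ℝ) T) => eLpNorm (u t) 3 volume) t ht
  refine FluidPDE.memLqLp_of_ae_eLpNorm_le h.ne measure_Ioo_lt_top.ne ?_ ?_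
  · refine (ae_restrict_iff' measurableSet_Ioo).2 (Eventually.of_forall fun t ht => ?_)
    exact ⟨hmeas t (Ioo_subset_Ico_self ht), (hle t (Ioo_subset_Ico_self ht)).trans_lt h⟩
  · exact (ae_restrict_iff' measurableSet_Ioo).2
      (Eventually.of_forall fun t ht => hle t (Ioo_subset_Ico_self ht))

/-- **From an essential to a pointwise bound for continuous fields.** If `u` is jointly
continuous on `(δ, T) × ℝ³` and `u ∈ L^∞(δ, T; L^∞(ℝ³))` (`Fluid.MemLqLp ∞ ∞ u (Ioo δ T)`), then
`‖u(t, x)‖ ≤ M` for **all** `t ∈ (δ, T)` and `x`, with `M = ‖u‖_{L^∞_t L^∞_x}`: the set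
`{(t, x) : ‖u(t,x)‖ > M}` is open (continuity) and null (its `t`-slices are null for a.e. `t`,
Tonelli), hence empty (Lebesgue measure charges open sets). This turns ESS (3.6) for the
a.e.-defined field into the `max` over `ℝ³ × [δ, T']` of its continuous representative. [folklore] -/
theorem exists_forall_norm_le_of_memLqLp_top_top {δ T : ℝ}
    {u : ℝ → EuclideanSpace ℝ (Fin 3) → EuclideanSpace ℝ (Fin 3)}
    (hcont : ContinuousOn (uncurry u) (Ioo δ T ×ˢ univ)) (h : FluidPDE.MemLqLp ∞ ∞ u (Ioo δ T)) :
    ∃ M : ℝ, ∀ t ∈ Ioo δ T, ∀ x, ‖u t x‖ ≤ M := by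
  set N : ℝ≥0∞ := FluidPDE.eLqLpNorm ∞ ∞ u (Ioo δ T) with hN
  have hNtop : N ≠ ∞ := h.2.ne
  refine ⟨N.toReal, fun t ht x => ?_⟩
  -- the open set where the bound fails
  set A : Set (ℝ × EuclideanSpace ℝ (Fin 3)) :=
    (Ioo δ T ×ˢ univ) ∩ (fun z => ‖uncurry u z‖) ⁻¹' Ioi N.toReal with hA
  have hAo : IsOpen A := hcont.norm.isOpen_inter_preimage (isOpen_Ioo.prod isOpen_univ) isOpen_Ioi
  -- its slices are null for a.e. `t`
  have hae : ∀ᵐ s ∂(volume : Measure ℝ), s ∈ Ioo δ T → eLpNorm (u s) ∞ volume ≤ N :=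
    (ae_restrict_iff' measurableSet_Ioo).1 h.ae_eLpNorm_le_top
  have hslice : (fun s => (volume : Measure (EuclideanSpace ℝ (Fin 3))) (Prod.mk s ⁻¹' A))
      =ᵐ[volume] 0 := by
    filter_upwards [hae] with s hs
    by_cases hsI : s ∈ Ioo δ T
    · have hb : ∀ᵐ y ∂(volume : Measure (EuclideanSpace ℝ (Fin 3))), ‖u s y‖ ≤ N.toReal := by
        have h1 := ae_le_eLpNormEssSup (f := u s) (μ := (volume : Measure (EuclideanSpace ℝ (Fin 3))))
        have h2 : eLpNormEssSup (u s) volume ≤ N := by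
          rw [← eLpNorm_exponent_top]
          exact hs hsI
        filter_upwards [h1] with y hy
        rw [← ENNReal.toReal_ofReal (norm_nonneg (u s y)), ← ofReal_norm] at *
        exact ENNReal.toReal_mono hNtop ((hy.trans h2))
      have hset : Prod.mk s ⁻¹' A = {y | ¬ ‖u s y‖ ≤ N.toReal} := by
        ext y
        simp only [hA, mem_preimage, mem_inter_iff, mem_prod, mem_univ, and_true, mem_Ioi,
          uncurry_apply_pair, mem_setOf_eq, not_le]
        exact ⟨fun h => h.2, fun h => ⟨hsI, h⟩⟩
      rw [Pi.zero_apply, hset]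
      exact ae_iff.1 hb
    · have hset : Prod.mk s ⁻¹' A = ∅ := by
        ext y
        simp only [hA, mem_preimage, mem_inter_iff, mem_prod, mem_univ, and_true,
          mem_empty_iff_false, iff_false, not_and]
        exact fun h => absurd h hsI
      rw [hset, Pi.zero_apply, measure_empty]
  have hA0 : (volume : Measure (ℝ × EuclideanSpace ℝ (Fin 3))) A = 0 := by
    rw [Measure.volume_eq_prod]
    exact (Measure.measure_prod_null hAo.measurableSet).2 hslice
  -- so `A` is empty
  have hAe : A = ∅ := hAo.eq_empty_of_measure_zero hA0
  by_contra hlt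
  have hmem : (t, x) ∈ A := ⟨⟨ht, mem_univ _⟩, by simpa [hA] using not_le.1 hlt⟩
  rw [hAe] at hmem
  exact hmem

/-! ### Assembly 1: from Seregin's criterion and Tao's regularity persistence -/

/-- **The `L³` continuation criterion from Seregin's blow-up criterion** (Seregin 2012, Thm. 1.1,
contrapositive; Escauriaza–Seregin–Šverák 2003, Thm. 1.3 for the `limsup` form; the boundedness on
closed sub-strips from Tao 2013, Cor. 11.1 + Cor. 4.3 + Thm. 5.4 (iv)). Given the named facts
`NS.seregin_L3_blowup` and `NS.tao2011_hasBoundedSobolevNormsOn`, every classical unforced solution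
on `ℝ³ × [0, T)` which is Leray–Hopf from its rapidly decaying datum and has
`sup_{0 ≤ t < T} ‖u(t)‖_{L³} < ∞` extends as a classical solution past `T`. Proof: if not, `(u, p)`
is a maximal smooth solution with lifespan `T`; `u 0 ∈ L³` (continuous, norm below the supremum);
`u` is essentially bounded on every `[0, T'] × ℝ³`, `T' < T`
(`eLpNorm_uncurry_top_lt_top_of_tao2011`); so Seregin's theorem forces `‖u(t)‖₃ → ∞` as `t ↑ T`,
contradicting the uniform bound (`not_tendsto_eLpNorm_three_top_of_iSup_lt_top`). [cite: Seregin2012, Thm. 1.1] -/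
theorem hasSmoothExtensionPast_of_eLpNorm_three_bounded_of_seregin (hS : seregin_L3_blowup)
    (hB : tao2011_hasBoundedSobolevNormsOn) : hasSmoothExtensionPast_of_eLpNorm_three_bounded := by
  intro ν T hν hT u p hsol hLH h₀ h₃
  by_contra hnot
  -- `(u, p)` is a maximal smooth solution with lifespan `T`
  have hmax : FluidPDE.IsMaximalSmoothSolution ν 0 u p T := ⟨hsol, hnot⟩
  -- the datum lies in `L³`
  have h0T : (0 : ℝ) ∈ Ico 0 T := ⟨le_rfl, hT⟩
  have hdat : MemLp (u 0) 3 volume := by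
    refine ⟨(hsol.contDiff_velocity h0T).continuous.aestronglyMeasurable, ?_⟩
    exact lt_of_le_of_lt
      (le_iSup₂ (f := fun t (_ : t ∈ Ico (0 : ℝ) T) => eLpNorm (u t) 3 volume) 0 h0T) h₃
  -- boundedness on closed sub-strips (Tao + Sobolev imbedding)
  have hbdd := eLpNorm_uncurry_top_lt_top_of_tao2011 hB hν hsol hLH h₀
  -- Seregin: the `L³` norm blows up at `T`; contradiction with the uniform bound
  exact not_tendsto_eLpNorm_three_top_of_iSup_lt_top hT h₃ (hS hν hT hmax hLH hdat hbdd)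

/-- The same assembly from Tao's two printed ingredients separately — Cor. 11.1 (bounded
enstrophy, `tao2011_boundedEnstrophy`) and Cor. 4.3 + Thm. 5.4 (iv) (`H^k` persistence for `H¹`
mild solutions, `tao2011_hasBoundedSobolevNormsOn_of_memSobolevX`) — via the in-tree assembly
`tao2011_hasBoundedSobolevNormsOn_of_parts`. [cite: Seregin2012, Thm. 1.1] -/
theorem hasSmoothExtensionPast_of_eLpNorm_three_bounded_of_parts (hS : seregin_L3_blowup)
    (hA : tao2011_boundedEnstrophy) (hB : tao2011_hasBoundedSobolevNormsOn_of_memSobolevX) :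
    hasSmoothExtensionPast_of_eLpNorm_three_bounded :=
  hasSmoothExtensionPast_of_eLpNorm_three_bounded_of_seregin hS
    (tao2011_hasBoundedSobolevNormsOn_of_parts hA hB)

/-! ### Assembly 2: from ESS (3.6) and Leray's `L^∞` rate -/

/-- **Leray's rate excludes a bounded regular solution at a blow-up time** (Leray 1934, §20
(3.9), "premier caractère des irrégularités"). Given `NS.leray_blowup_rate_top`: a maximal smooth
solution with lifespan `T > 0` (viscosity `ν > 0`) which is Leray–Hopf from its datum cannot be
bounded on `[0, T) × ℝ³` — for then it is bounded on every closed sub-strip, Leray's inequality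
`c √ν / √(T - t) ≤ ‖u(t)‖_∞ ≤ M` holds for all `t < T`, and fails for `T - t` small. [cite: Leray1934, Acta Math. 63 §20 (3.9)] -/
theorem not_forall_norm_le_of_leray (hL : leray_blowup_rate_top) {ν T : ℝ} (hν : 0 < ν)
    (hT : 0 < T) {u : ℝ → EuclideanSpace ℝ (Fin 3) → EuclideanSpace ℝ (Fin 3)}
    {p : ℝ → EuclideanSpace ℝ (Fin 3) → ℝ} (hmax : FluidPDE.IsMaximalSmoothSolution ν 0 u p T)
    (hLH : FluidPDE.IsLerayHopfOn T ν 0 (u 0) u) {M : ℝ} (hM : ∀ t ∈ Ico 0 T, ∀ x, ‖u t x‖ ≤ M) :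
    False := by
  obtain ⟨c, hc, hrate⟩ := hL
  have hbdd : ∀ T' ∈ Ioo 0 T, eLpNorm (uncurry u) ∞
      ((volume : Measure (ℝ × EuclideanSpace ℝ (Fin 3))).restrict (Icc 0 T' ×ˢ univ)) < ∞ :=
    fun T' hT' => eLpNorm_uncurry_top_lt_top_of_bound measurableSet_Icc (C := M)
      fun t ht x => hM t ⟨ht.1, ht.2.trans_lt hT'.2⟩ x
  have hr := hrate ν T hν hT u p hmax hLH hbdd
  have hM0 : 0 ≤ M := (norm_nonneg _).trans (hM 0 ⟨le_rfl, hT⟩ 0)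
  -- `c √ν / √(T - t) ≤ M` for all `t ∈ [0, T)`
  have hle : ∀ t ∈ Ico 0 T, c * Real.sqrt ν / Real.sqrt (T - t) ≤ M := by
    intro t ht
    have h2 : eLpNorm (u t) ∞ volume ≤ ENNReal.ofReal M := by
      rw [eLpNorm_exponent_top]
      exact eLpNormEssSup_le_of_ae_bound (Eventually.of_forall fun x => hM t ht x)
    exact (ENNReal.ofReal_le_ofReal_iff hM0).1 ((hr t ht).trans h2)
  -- choose `t = T - ε` with `ε` small
  set K : ℝ := c * Real.sqrt ν with hK
  have hKpos : 0 < K := mul_pos hc (Real.sqrt_pos.2 hν)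
  have hM1 : 0 < M + 1 := by linarith
  set ε : ℝ := min T ((K / (M + 1)) ^ 2) with hε
  have hεpos : 0 < ε := lt_min hT (by positivity)
  have hεle : ε ≤ T := min_le_left _ _
  have h1 := hle (T - ε) ⟨by linarith, by linarith⟩
  rw [show T - (T - ε) = ε by ring] at h1
  have hsqrt : Real.sqrt ε ≤ K / (M + 1) :=
    calc Real.sqrt ε ≤ Real.sqrt ((K / (M + 1)) ^ 2) := Real.sqrt_le_sqrt (min_le_right _ _)
      _ = K / (M + 1) := Real.sqrt_sq (by positivity)
  have hsqrt_pos : 0 < Real.sqrt ε := Real.sqrt_pos.2 hεpos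
  have h3 : M + 1 ≤ K / Real.sqrt ε := by
    rw [le_div_iff₀ hsqrt_pos]
    calc (M + 1) * Real.sqrt ε ≤ (M + 1) * (K / (M + 1)) :=
          mul_le_mul_of_nonneg_left hsqrt hM1.le
      _ = K := by field_simp
  linarith

/-- **The `L³` continuation criterion from ESS (3.6) and Leray's rate** (Escauriaza–Seregin–Šverák
2003, Thm. 1.3 via §3 (3.5)–(3.6); Leray 1934, §20 (3.9)). Given the named facts
`NS.ess_sup_bound` and `NS.leray_blowup_rate_top`, every classical unforced solution on
`ℝ³ × [0, T)` which is Leray–Hopf from its rapidly decaying datum and has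
`sup_{0 ≤ t < T} ‖u(t)‖_{L³} < ∞` extends as a classical solution past `T`. Proof (module
docstring): if not, `(u, p)` is maximal with lifespan `T`; `u ∈ L^∞(0,T; L³)` with datum in `J̊`,
so ESS (3.6) bounds `u` on `ℝ³ × (δ, T)` for every `δ > 0` (pointwise, by continuity:
`exists_forall_norm_le_of_memLqLp_top_top`); restarting at an energy-good time `s ∈ (0, T)`
(`Fluid.IsLerayHopfOn.exists_isLerayHopfOn_translate`) gives a maximal smooth solution
`u(· + s)` with lifespan `T - s` (`Fluid.IsMaximalSmoothSolution.translate_zero`), Leray–Hopf from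
`u(s)` and bounded on `[0, T - s) × ℝ³`, which Leray's rate forbids
(`not_forall_norm_le_of_leray`). The rapid decay of the datum is not used. [cite: EscauriazaSereginSverak2003, Thm. 1.3 with §3 (3.5)–(3.6)] -/
theorem hasSmoothExtensionPast_of_eLpNorm_three_bounded_of_ess_sup_bound (h36 : ess_sup_bound)
    (hL : leray_blowup_rate_top) : hasSmoothExtensionPast_of_eLpNorm_three_bounded := by
  intro ν T hν hT u p hsol hLH _h₀ h₃
  by_contra hnot
  -- `(u, p)` is a maximal smooth solution with lifespan `T`
  have hmax : FluidPDE.IsMaximalSmoothSolution ν 0 u p T := ⟨hsol, hnot⟩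
  -- `u ∈ L^∞(0, T; L³)` with datum in `J̊`
  have hL3 : FluidPDE.MemLqLp ∞ 3 u (Ioo 0 T) := memLqLp_top_three_of_iSup_lt_top
    (fun t ht => (hsol.contDiff_velocity ht).continuous.aestronglyMeasurable) h₃
  have hdat2 : MemLp (u 0) 2 volume := hLH.memLp 0 ⟨le_rfl, hT.le⟩
  have hdiv0 : FluidPDE.IsWeaklyDivFree (u 0) := hLH.isWeaklyDivFree_datum hT
  -- ESS (3.6): essentially bounded on `(δ, T) × ℝ³` for every `δ > 0`
  have hbd : ∀ δ ∈ Ioo 0 T, FluidPDE.MemLqLp ∞ ∞ u (Ioo δ T) := h36 hν hT hdat2 hdiv0 hLH hL3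
  -- an energy-good restarting time `s ∈ (0, T)`
  obtain ⟨s, hs, hLHs⟩ := hLH.exists_isLerayHopfOn_translate hsol hν.le hT le_rfl
  -- a pointwise bound on `(s/2, T) × ℝ³`
  have hs2 : s / 2 ∈ Ioo 0 T := ⟨by linarith [hs.1], by linarith [hs.2]⟩
  have hcont : ContinuousOn (uncurry u) (Ioo (s / 2) T ×ˢ univ) :=
    hsol.smooth_velocity.continuousOn.mono
      (prod_mono (fun t ht => ⟨hs2.1.le.trans ht.1.le, ht.2⟩) Subset.rfl)
  obtain ⟨M, hM⟩ := exists_forall_norm_le_of_memLqLp_top_top hcont (hbd (s / 2) hs2)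
  -- the translate: maximal with lifespan `T - s`, Leray–Hopf from `u s`, bounded on `[0, T - s)`
  have hmaxs : FluidPDE.IsMaximalSmoothSolution ν 0 (fun t => u (t + s)) (fun t => p (t + s))
      (T - s) := hmax.translate_zero hs.1 hs.2
  have hLHs' : FluidPDE.IsLerayHopfOn (T - s) ν 0 ((fun t => u (t + s)) 0) (fun t => u (t + s)) := by
    show FluidPDE.IsLerayHopfOn (T - s) ν 0 (u (0 + s)) (fun t => u (t + s))
    rw [zero_add]
    exact hLHs
  have hMs : ∀ t ∈ Ico 0 (T - s), ∀ x, ‖(fun t => u (t + s)) t x‖ ≤ M := fun t ht x =>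
    hM (t + s) ⟨by linarith [ht.1, hs.1], by linarith [ht.2]⟩ x
  exact not_forall_norm_le_of_leray hL hν (by linarith [hs.2]) hmaxs hLHs' hMs

/-- **The preferred decomposition, from the second-layer ESS facts.** Combining assembly 2 with
nothing else: `hasSmoothExtensionPast_of_eLpNorm_three_bounded` holds as soon as ESS (3.6)
(`ess_sup_bound`) and Leray's rate (`leray_blowup_rate_top`) are discharged; recorded as the
implication from the conjunction for the dependency tracker. [cite: EscauriazaSereginSverak2003, Thm. 1.3 with §3 (3.5)–(3.6)] -/
theorem hasSmoothExtensionPast_of_eLpNorm_three_bounded_of_and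
    (h : ess_sup_bound ∧ leray_blowup_rate_top) : hasSmoothExtensionPast_of_eLpNorm_three_bounded :=
  hasSmoothExtensionPast_of_eLpNorm_three_bounded_of_ess_sup_bound h.1 h.2

end Literature.Analysis.FluidPDE

end
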